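import Summits.CriticalPhenomena.PercolationContinuityZ3.Theorems.Transplant.GrigorchukLamplighterCylinderKits
import HarnessLib

/-!
# Cylinder kits on Bartholdi–Erschler's graph, III: KIT 3 (an `a`-edge: the lamp rectangle through both axes) and the zone radius

builds on p205010 (kernel theorem, internal audit signed; external expert review pending) — nothing in this file uses p205010.  Lane `prim-bschramm`, seat `prim-bschramm-p3` gen 38 (DESIGN OWNER; offer O17 = O3-direct,
`P3-NILPOTENT.md` §31).  Helper file (`--supports stmt-CriticalPhenomena-4575 --as helper`).  Sequel of «GrigorchukLamplighterCylinderKits».  Nothing is claimed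
here about `θ(p_c)`.

* §5 **KIT 3** (`kit3`), `e = {x, x a}` (`x = (f, g)`, lamp positions `P₁ = g·ρ` in block `i = idx x` and `P₂ = g·a·ρ` in the OTHER block `i′`): `A` = the column of
  `x` up to `p = (f + K δ₁, g)`; the run `M` = `p —a→ (f+Kδ₁, g a) —s^{K′}→ (f+Kδ₁+K′δ₂, g a) —a→ (f+Kδ₁+K′δ₂, g) —s^{−K}→ (f+K′δ₂, g) —a→ (f+K′δ₂, g a) = q`
  (`walkM3`; every vertex has block `i` or block `i′` at the ceiling `ℓ + 1` — `mem_walkM3` — so every edge is an enhancement edge), made a path by `Walk.bypass`;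
  `B` = the column of `x a` downwards; the closing identity `x s^K a s^{K′} a s^{−K} a = x a s^{K′}` is `corner_identity` (`a sⁿ a = s′ⁿ`, `[s, s′] = 1`);
  disjointness by tree parts (`g` vs `g a`, `genA ≠ 1`) and block sums (`K, K′ ≥ 1`).
* §6 the zone of any cycle kit lies in `B_H(x, |A| + |M| + |B| + 1)` (`cycleKit_Z_subset`); with `K ≤ 2ℓ + 2` all three kits fit in the radius `Rz ℓ = 8ℓ + 12`.
[cite: BalisterBollobasRiordan2014, §"bond percolation" p. 13] [cite: AizenmanGrimmett1991, Thm 1 (essential enhancements)] [cite: BartholdiErschler2012, §2, §3.1]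
-/

noncomputable section

namespace Summit.CriticalPhenomena.PercolationContinuityZ3.Theorems.Transplant

namespace Grigorchuk

open SimpleGraph Walk SemidirectProduct Literature.Probability.LatticeModels SubLoc CayCyl
open Literature.Barriers.CriticalPhenomena (graphBall graphBall_mono)
open scoped Classical

section Kit

variable {ℓ : ℕ} (x y : ↥(blockCyl (box 2 (ℓ + 1))))

/-! ## §5 Kit 3: the edge `{x, x a}` (a corner: the lamp rectangle through both axes) -/

/-- `s` and `s′ = a s a` commute (two lamps). [cite: BartholdiErschler2012, §2] -/
theorem sW_s'W_comm : Commute sW s'W := Subtype.ext (by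
  change (lamp rho 1 : LampGroup ℤ) * lamp (genA rho) 1 = lamp (genA rho) 1 * lamp rho 1
  rw [lamp, lamp, ← MonoidHom.map_mul, ← MonoidHom.map_mul, mul_comm])

/-- `a sⁿ a = s′ⁿ`. [cite: BartholdiErschler2012, §2 (conjugates of lamp letters)] -/
theorem aW_sW_pow_aW (n : ℕ) : aW * sW ^ n * aW = s'W ^ n := by
  calc aW * sW ^ n * aW = aW * sW ^ n * aW⁻¹ := by rw [letters_inv.1]
    _ = (aW * sW * aW⁻¹) ^ n := conj_pow.symm
    _ = (aW * sW * aW) ^ n := by rw [letters_inv.1]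
    _ = s'W ^ n := by rw [aW_mul_sW_mul_aW]

/-- **The corner identity**: `u s^K a s^{K′} a s^{−K} a = u a s^{K′}`. [folklore] -/
theorem corner_identity (u : ↥wreathZ) (k k' : ℕ) : u * sW ^ k * aW * sW ^ k' * aW * sW⁻¹ ^ k * aW = u * aW * sW ^ k' := by
  have h1 : sW ^ k * s'W ^ k' = s'W ^ k' * sW ^ k := (sW_s'W_comm.pow_pow k k').eq
  calc u * sW ^ k * aW * sW ^ k' * aW * sW⁻¹ ^ k * aW
      = u * sW ^ k * (aW * sW ^ k' * aW) * sW⁻¹ ^ k * aW := by simp only [mul_assoc]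
    _ = u * sW ^ k * s'W ^ k' * sW⁻¹ ^ k * aW := by rw [aW_sW_pow_aW]
    _ = u * (sW ^ k * s'W ^ k') * sW⁻¹ ^ k * aW := by simp only [mul_assoc]
    _ = u * (s'W ^ k' * sW ^ k) * sW⁻¹ ^ k * aW := by rw [h1]
    _ = u * s'W ^ k' * (sW ^ k * sW⁻¹ ^ k) * aW := by simp only [mul_assoc]
    _ = u * s'W ^ k' * aW := by rw [inv_pow, mul_inv_cancel, mul_one]
    _ = u * (aW * sW ^ k' * aW) * aW := by rw [aW_sW_pow_aW]
    _ = u * aW * sW ^ k' * (aW * aW) := by simp only [mul_assoc]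
    _ = u * aW * sW ^ k' := by rw [aW_mul_aW, mul_one]

section Kit3

variable {x y} (hxy : y.1 = x.1 * aW) (hx : bs x.1 ∈ box 2 ℓ)

include hxy in
/-- Across the corner: same block sums, the OTHER block index, tree part times `a`. [folklore] -/
theorem bs_eq_of_corner : bs y.1 = bs x.1 ∧ idx y.1 ≠ idx x.1 ∧ ((y.1 : LampGroup ℤ)).right = ((x.1 : LampGroup ℤ)).right * genA := by
  rw [hxy]; exact ⟨bs_mul_tree x.1 (t := aW) rfl, idx_mul_aW x.1, by rw [right_mul]; rfl⟩

/-- The first corner vertex `p a`. [folklore] -/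
abbrev v₁ (x : ↥(blockCyl (box 2 (ℓ + 1)))) : ↥wreathZ := pt x * aW

/-- The `a`-neighbour `C a` of the opposite corner `C = p a s^{K′}`. [folklore] -/
abbrev v₂ (x y : ↥(blockCyl (box 2 (ℓ + 1)))) : ↥wreathZ := v₁ x * sW ^ K y * aW

/-- The last vertex before the column of `y`: `D = C a s^{−K}`. [folklore] -/
abbrev v₃ (x y : ↥(blockCyl (box 2 (ℓ + 1)))) : ↥wreathZ := v₂ x y * sW⁻¹ ^ K x

/-- **The corner run** `p → p a → ⋯ → C → C a → ⋯ → D → D a` in `Cay`. [folklore] -/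
def walkM3 (x y : ↥(blockCyl (box 2 (ℓ + 1)))) : CayS.Walk (pt x) (v₃ x y * aW) :=
  (Walk.cons (cay_adj_aW (pt x)) (powWalk stdGens cay_adj_sW (v₁ x) (K y))).append
    ((Walk.cons (cay_adj_aW (v₁ x * sW ^ K y)) (powWalk stdGens cay_adj_sWi (v₂ x y) (K x))).append
      (Walk.cons (cay_adj_aW (v₃ x y)) Walk.nil))

/-- The corner run has length `K y + K x + 3`. [folklore] -/
theorem length_walkM3 : (walkM3 x y).length = K x + K y + 3 := by
  rw [walkM3, length_append, length_cons, length_powWalk, length_append, length_cons, length_powWalk, length_cons, length_nil]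
  omega

include hxy in
/-- The corner run ends at the top of the column of `y`: `D a = y s^{K′}`. [folklore] -/
theorem v₃_mul_aW : v₃ x y * aW = pt y := by
  rw [v₃, v₂, v₁, pt, pt, hxy]; exact corner_identity x.1 (K x) (K y)

include hxy in
/-- Coordinates of `v₁ sʲ`: tree part `g a`, block `idx x` at the ceiling, block `idx y` climbing from `bs x`. [folklore] -/
theorem coord₁ (j : ℕ) : (((v₁ x * sW ^ j : ↥wreathZ)) : LampGroup ℤ).right = ((x.1 : LampGroup ℤ)).right * genA ∧
    bs (v₁ x * sW ^ j) (idx x.1) = ℓ + 1 ∧ bs (v₁ x * sW ^ j) (idx y.1) = bs x.1 (idx y.1) + j := by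
  have hc := bs_eq_of_corner hxy
  have hi1 : idx (v₁ x) = idx y.1 := by
    rw [v₁]
    have h := idx_mul_aW (pt x)
    rw [(bs_pt x).2.1] at h
    have h2 := hc.2.1
    revert h h2; generalize idx (pt x * aW) = a; generalize idx y.1 = b; generalize idx x.1 = c; intro h h2; omega
  have hb1 : bs (v₁ x) = bs (pt x) := bs_mul_tree (pt x) (t := aW) rfl
  refine ⟨?_, ?_, ?_⟩
  · rw [right_mul_sW_pow, v₁, right_mul, (bs_pt x).2.2]; rfl
  · rw [(bs_mul_sW_pow _ j).1, hi1, Pi.add_apply, Pi.single_eq_of_ne hc.2.1.symm, hb1, bs_pt_idx]; ring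
  · rw [(bs_mul_sW_pow _ j).1, hi1, Pi.add_apply, Pi.single_eq_same, hb1, bs_pt_ne x hc.2.1]

include hxy in
/-- Coordinates of `v₂ s^{−j}`: tree part `g`, block `idx y` at the ceiling, block `idx x` descending from the ceiling. [folklore] -/
theorem coord₂ (j : ℕ) : (((v₂ x y * sW⁻¹ ^ j : ↥wreathZ)) : LampGroup ℤ).right = ((x.1 : LampGroup ℤ)).right ∧
    bs (v₂ x y * sW⁻¹ ^ j) (idx y.1) = ℓ + 1 ∧ bs (v₂ x y * sW⁻¹ ^ j) (idx x.1) = ℓ + 1 - j := by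
  have hc := bs_eq_of_corner hxy
  have h1 := coord₁ hxy (K y)
  have hr2 : (((v₂ x y : ↥wreathZ)) : LampGroup ℤ).right = ((x.1 : LampGroup ℤ)).right := by
    rw [v₂, right_mul, h1.1, mul_assoc]; change _ * (genA * genA) = _; rw [genA_mul_genA, mul_one]
  have hi2 : idx (v₂ x y) = idx x.1 := by unfold idx; rw [hr2]
  have hb2 : bs (v₂ x y) = bs (v₁ x * sW ^ K y) := bs_mul_tree _ (t := aW) rfl
  refine ⟨by rw [right_mul_sWi_pow, hr2], ?_, ?_⟩
  · rw [(bs_mul_sWi_pow _ j).1, hi2, Pi.add_apply, Pi.single_eq_of_ne hc.2.1, hb2, h1.2.2, K_eq, hc.1]; ring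
  · rw [(bs_mul_sWi_pow _ j).1, hi2, Pi.add_apply, Pi.single_eq_same, hb2, h1.2.1]; ring

include hxy in
/-- **Classification of the run's vertices**: the top `p`, the top `q = y s^{K′}`, or a vertex with tree part `g a` and block `idx x` at the ceiling,
or a vertex with tree part `g` and block `idx y` at the ceiling — in all cases inside the big cylinder and outside the small one. [folklore] -/
theorem mem_walkM3 {z : ↥wreathZ} (hz : z ∈ (walkM3 x y).support) :
    (z = pt x ∨ z = pt y ∨
      (((z : LampGroup ℤ)).right = ((x.1 : LampGroup ℤ)).right * genA ∧ bs z (idx x.1) = ℓ + 1) ∨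
      (((z : LampGroup ℤ)).right = ((x.1 : LampGroup ℤ)).right ∧ bs z (idx y.1) = ℓ + 1)) ∧
    z ∈ blockCyl (box 2 (ℓ + 1)) ∧ bs z ∉ box 2 ℓ := by
  have hc := bs_eq_of_corner hxy
  have hxb := mem_box.1 (mem_blockCyl_bs.1 x.2)
  have eK := K_eq x; have eK' := K_eq y
  -- a vertex is in the big cylinder and outside the small one as soon as one block sum is `ℓ+1` and the other is within bounds
  have crit : ∀ w : ↥wreathZ, ∀ i : Fin 2, bs w i = ℓ + 1 → (∀ j, j ≠ i → -((ℓ : ℤ) + 1) ≤ bs w j ∧ bs w j ≤ ℓ + 1) →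
      w ∈ blockCyl (box 2 (ℓ + 1)) ∧ bs w ∉ box 2 ℓ := by
    intro w i hi hj
    refine ⟨mem_blockCyl_bs.2 (mem_box.2 fun j => ?_), fun h => by have := (mem_box.1 h) i; omega⟩
    by_cases hji : j = i
    · subst hji; push_cast; omega
    · have := hj j hji; push_cast; omega
  have other : ∀ j : Fin 2, j ≠ idx x.1 → j = idx y.1 := by
    have := hc.2.1; intro j hj; revert this hj; generalize idx x.1 = a; generalize idx y.1 = b; omega
  have other' : ∀ j : Fin 2, j ≠ idx y.1 → j = idx x.1 := fun j hj => by
    by_contra h; exact hj (other j h)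
  rw [walkM3, mem_support_append_iff, support_cons, List.mem_cons, mem_support_append_iff, support_cons, List.mem_cons,
    support_cons, support_nil, List.mem_cons, List.mem_singleton] at hz
  rcases hz with (rfl | hz) | (rfl | hz) | (rfl | rfl)
  · -- z = p
    refine ⟨Or.inl rfl, (pV x).2, bs_pt_not_mem x⟩
  · -- on the run p a s^j
    obtain ⟨j, hj, rfl⟩ := (mem_support_powWalk _).1 hz
    have h := coord₁ hxy j
    have hj' : (j : ℤ) ≤ K y := by exact_mod_cast hj
    refine ⟨Or.inr (Or.inr (Or.inl ⟨h.1, h.2.1⟩)), crit _ _ h.2.1 fun i hi => ?_⟩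
    rw [other i hi, h.2.2]; have := hxb (idx y.1); rw [hc.1] at eK'; constructor <;> omega
  · -- z = C = v₁ s^{K'}
    have h := coord₁ hxy (K y)
    refine ⟨Or.inr (Or.inr (Or.inl ⟨h.1, h.2.1⟩)), crit _ _ h.2.1 fun i hi => ?_⟩
    rw [other i hi, h.2.2]; have := hxb (idx y.1); rw [hc.1] at eK'; constructor <;> omega
  · -- on the run C a s^{-j}
    obtain ⟨j, hj, rfl⟩ := (mem_support_powWalk _).1 hz
    have h := coord₂ hxy j
    have hj' : (j : ℤ) ≤ K x := by exact_mod_cast hj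
    refine ⟨Or.inr (Or.inr (Or.inr ⟨h.1, h.2.1⟩)), crit _ _ h.2.1 fun i hi => ?_⟩
    rw [other' i hi, h.2.2]; have := hxb (idx x.1); constructor <;> omega
  · -- z = D = v₂ s^{-K}
    have h := coord₂ hxy (K x)
    refine ⟨Or.inr (Or.inr (Or.inr ⟨h.1, h.2.1⟩)), crit _ _ h.2.1 fun i hi => ?_⟩
    rw [other' i hi, h.2.2]; have := hxb (idx x.1); constructor <;> omega
  · -- z = D a = q
    rw [v₃_mul_aW hxy]
    refine ⟨Or.inr (Or.inl rfl), (pV y).2, bs_pt_not_mem y⟩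

/-- The tree part `g a` differs from `g`. [folklore] -/
theorem right_mul_genA_ne : ((x.1 : LampGroup ℤ)).right * genA ≠ ((x.1 : LampGroup ℤ)).right := fun h =>
  genA_ne_one (mul_left_cancel (a := ((x.1 : LampGroup ℤ)).right) (by rw [mul_one]; exact h))

include hxy hx in
/-- **KIT 3** (corner edge `{x, x a}`): column of `x` up, the lamp rectangle `p → p a → C → C a → D → D a = q` outside the small cylinder, column of
`x a` down. [cite: BalisterBollobasRiordan2014, §"bond percolation" p. 13] -/
def kit3 : CycleKit (cylH (ℓ + 1)) (Eenh ℓ) x y where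
  p := pV x
  q := pV y
  A := colA x
  M := (((walkM3 x y).induce (blockCyl (box 2 (ℓ + 1))) fun z hz => (mem_walkM3 hxy hz).2.1).copy rfl
    (Subtype.ext (v₃_mul_aW hxy))).bypass
  B := (colA y).reverse
  hA := (colA_isPath x).1
  hM := bypass_isPath _
  hB := (colA_isPath y).1.reverse
  hpq := fun h => by
    have e := congrArg (fun w : ↥(blockCyl (box 2 (ℓ + 1))) => ((w.1 : LampGroup ℤ)).right) h
    simp only [(bs_pt x).2.2, (bs_pt y).2.2, (bs_eq_of_corner hxy).2.2] at e
    exact right_mul_genA_ne e.symm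
  hxp := fun h => by
    have e : bs x.1 (idx x.1) = bs (pt x) (idx x.1) := by rw [show pt x = x.1 from (congrArg Subtype.val h).symm]
    rw [bs_pt_idx] at e
    have := (mem_box.1 hx) (idx x.1); omega
  hqy := fun h => by
    have hy : bs y.1 ∈ box 2 ℓ := by rw [(bs_eq_of_corner hxy).1]; exact hx
    have e : bs y.1 (idx y.1) = bs (pt y) (idx y.1) := by rw [show pt y = y.1 from congrArg Subtype.val h]
    rw [bs_pt_idx] at e
    have := (mem_box.1 hy) (idx y.1); omega
  hAM := fun w hwA hwM => by
    obtain ⟨i, -, hi⟩ := mem_colA x hwA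
    have hwM' : w.1 ∈ (walkM3 x y).support := by
      have h1 := support_bypass_subset_support _ hwM
      rw [support_copy] at h1
      exact (mem_support_induce_iff _ _ w).1 h1
    have hr : ((w.1 : LampGroup ℤ)).right = ((x.1 : LampGroup ℤ)).right := by rw [hi, right_mul_sW_pow]
    have hb : bs w.1 (idx y.1) = bs x.1 (idx y.1) := by
      rw [hi, (bs_mul_sW_pow x.1 i).1, Pi.add_apply, Pi.single_eq_of_ne (bs_eq_of_corner hxy).2.1, add_zero]
    rcases (mem_walkM3 hxy hwM').1 with h | h | ⟨h, -⟩ | ⟨-, h⟩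
    · exact Subtype.ext h
    · rw [h, (bs_pt y).2.2, (bs_eq_of_corner hxy).2.2] at hr; exact absurd hr (right_mul_genA_ne (x := x))
    · rw [hr] at h; exact absurd h.symm (right_mul_genA_ne (x := x))
    · rw [hb] at h
      have hy : bs y.1 ∈ box 2 ℓ := by rw [(bs_eq_of_corner hxy).1]; exact hx
      have := (mem_box.1 hy) (idx y.1); rw [(bs_eq_of_corner hxy).1] at this; omega
  hMB := fun w hwM hwB => by
    obtain ⟨j, -, hj⟩ := mem_colA y ((mem_support_reverse_iff _ w).1 hwB)
    have hwM' : w.1 ∈ (walkM3 x y).support := by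
      have h1 := support_bypass_subset_support _ hwM
      rw [support_copy] at h1
      exact (mem_support_induce_iff _ _ w).1 h1
    have hr : ((w.1 : LampGroup ℤ)).right = ((x.1 : LampGroup ℤ)).right * genA := by
      rw [hj, right_mul_sW_pow, (bs_eq_of_corner hxy).2.2]
    have hb : bs w.1 (idx x.1) = bs x.1 (idx x.1) := by
      rw [hj, (bs_mul_sW_pow y.1 j).1, Pi.add_apply, Pi.single_eq_of_ne (bs_eq_of_corner hxy).2.1.symm, add_zero,
        (bs_eq_of_corner hxy).1]
    rcases (mem_walkM3 hxy hwM').1 with h | h | ⟨-, h⟩ | ⟨h, -⟩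
    · rw [h, (bs_pt x).2.2] at hr; exact absurd hr.symm (right_mul_genA_ne (x := x))
    · exact Subtype.ext h
    · rw [hb] at h; have := (mem_box.1 hx) (idx x.1); omega
    · rw [hr] at h; exact absurd h (right_mul_genA_ne (x := x))
  hAB := fun w hwA hwB => by
    obtain ⟨i, -, hi⟩ := mem_colA x hwA
    obtain ⟨j, -, hj⟩ := mem_colA y ((mem_support_reverse_iff _ w).1 hwB)
    have e := congrArg (fun w : ↥wreathZ => ((w : LampGroup ℤ)).right) (hi.symm.trans hj)
    simp only [right_mul_sW_pow, (bs_eq_of_corner hxy).2.2] at e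
    exact right_mul_genA_ne (x := x) e.symm
  hME := fun d hd => by
    refine ⟨Walk.edges_subset_edgeSet _ hd, fun hall => ?_⟩
    induction d using Sym2.inductionOn with
    | hf a b =>
      have ha := Walk.fst_mem_support_of_mem_edges _ hd
      have ha' : a.1 ∈ (walkM3 x y).support := by
        have h1 := support_bypass_subset_support _ ha
        rw [support_copy] at h1
        exact (mem_support_induce_iff _ _ a).1 h1
      exact (mem_walkM3 hxy ha').2.2 (hall a (Sym2.mem_mk_left _ _))
  hyx := induce_adj.2 (show CayS.Adj y.1 x.1 by
    have h : CayS.Adj x.1 (x.1 * aW) := cay_adj_aW _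
    rw [← hxy] at h; exact h.symm)

include hxy hx in
/-- Kit 3 has columns of length `K x`, `K y` and a run of length at most `K x + K y + 3`. [folklore] -/
theorem kit3_lengths : (kit3 hxy hx).A.length = K x ∧ (kit3 hxy hx).M.length ≤ K x + K y + 3 ∧ (kit3 hxy hx).B.length = K y := by
  refine ⟨(colA_isPath x).2, ?_, by change (colA y).reverse.length = K y; rw [length_reverse, (colA_isPath y).2]⟩
  change ((((walkM3 x y).induce (blockCyl (box 2 (ℓ + 1))) fun z hz => (mem_walkM3 hxy hz).2.1).copy rfl
    (Subtype.ext (v₃_mul_aW hxy))).bypass).length ≤ K x + K y + 3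
  refine (length_bypass_le_length _).trans ?_
  rw [length_copy, length_induce, length_walkM3]

end Kit3

/-! ## §6 The zone radius -/

/-- The zone of a cycle kit lies in the ball of radius `|A| + |M| + |B| + 1` about `x`. [folklore] -/
theorem cycleKit_Z_subset {W : Type} {G : SimpleGraph W} {E' : Set (Sym2 W)} {a b : W} (Kt : CycleKit G E' a b) :
    Kt.Z ⊆ graphBall G a (Kt.A.length + Kt.M.length + Kt.B.length + 1) := by
  rintro w (hw | hw | hw)
  · refine ⟨Kt.A.takeUntil w hw, ?_⟩
    have := Kt.A.length_takeUntil_le_length hw; omega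
  · refine ⟨Kt.A.append (Kt.M.takeUntil w hw), ?_⟩
    have := Kt.M.length_takeUntil_le_length hw
    rw [Walk.length_append]; omega
  · have hw' : w ∈ Kt.B.reverse.support := (mem_support_reverse_iff _ w).2 hw
    refine ⟨Walk.cons Kt.hyx.symm (Kt.B.reverse.takeUntil w hw'), ?_⟩
    have := Kt.B.reverse.length_takeUntil_le_length hw'
    rw [length_reverse] at this
    rw [Walk.length_cons]; omega

/-- **The zone radius** `R ℓ = 8ℓ + 12`: every kit of a small-cylinder edge has `|A| + |M| + |B| + 1 ≤ R ℓ` (`K ≤ 2ℓ + 2`). [folklore] -/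
def Rz (ℓ : ℕ) : ℕ := 8 * ℓ + 12

end Kit

end Grigorchuk

end Summit.CriticalPhenomena.PercolationContinuityZ3.Theorems.Transplant

end
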